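import Summits.Ventures.LatticeQCDFlow.Scaling.StarSlowSwapLaw
import Summits.Ventures.LatticeQCDFlow.Scaling.TightSectorKLogKLaw

/-!
HONEST FRAMING: exact (Metropolis-corrected) sampling algorithms for lattice gauge theory; figures
of merit are autocorrelation/cost numbers at stated couplings and volumes; no continuum-physics
claim.

# StarSlowSwapWitnessTwoSided — THE SLOW-SWAP LAW OF CHAPTER U IS ORDER-SHARP: ON THE WITNESS FAMILY
# `(K/(t·p))·log((K+1)(1−ε−Kθ)) ≤ t_mix(ε) ≤ ⌈(15K/(p·t))·log((eK+1)/ε)⌉₊` FOR `4t ≤ h` — `Θ((K/(p·t))·log K)` FROM BOTH SIDES (lean-2 GEN-34, ours)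

Venture-side (OURS).  Cell `lqcd-flow` (pub-lqcd), unit `pub-lqcd-lean-2-g34`, 2026-08-29.  Chapter U, file 5.  The general-`q` slow-swap ceiling `StarSlowSwapLaw`
(`homStar_mixingTime_le_slowSwap''`) specialised to chapter O's witness (`S = Bool`, cold law `(θ, 1−θ)`, hot law `(pθ, 1−pθ)`, identity maps, exact hot redraws, idle cold
levels, a uniform entry list with `c ≥ 1` entries per level): there the persistence weights are `W(⊤) = 1/p`, `W(⊥) = (1−θ)/(1−pθ)`, so `W_lo = 1/p` and the logarithm is
`log((eK+1)/ε)`; chapter O's swap-budget floor (`boolWitness_mixingTime_ge_klogk`, `Scaling/TightSectorKLogKLaw`) is `(m/(t·c·p))·log((K+1)(1−ε−Kθ)) = (K/(t·p))·log(…)`.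

* **`boolWitness_slowSwap_mixingTime_two_sided`** — for `K ≥ 1`, `0 < t < 1`, `w_0 > 0`, `4t ≤ (1−t)w_0`, `0 < p ≤ 1`, `0 < θ < 1`, `0 < ε`, `ε + Kθ < 1`:
  **`(K/(t·p))·log((K+1)(1−ε−Kθ)) ≤ t_mix(ε) ≤ ⌈(15K/(p·t))·log((eK+1)/ε)⌉₊`** — at `θ ≤ 1/(4K)`, `ε = 1/4` both sides are `Θ((K/(p·t))·log K)`: the slow-swap law
  of OPEN-MATH item 1 (i) has the right order in `K`, `p` AND `t`, uniformly in the laws.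

NOT CLAIMED: sharpness of the constant `15` or of the logarithm's argument; anything measured.  Literature grade (cell rule): OWN; nothing cited as a fact; no new bib keys.
-/

noncomputable section
open Finset Function
open Literature.Probability.MarkovChains

namespace Summit.Ventures.LatticeQCDFlow.Scaling

section Witness
variable {K m : ℕ} (κ : Fin m → Fin K) {w : Fin (K + 1) → ℝ} {t p θ : ℝ}

/-- **CHAPTER U'S SLOW-SWAP LAW FROM BOTH SIDES ON THE WITNESS:** `(K/(t·p))·log((K+1)(1−ε−Kθ)) ≤ t_mix(ε) ≤ ⌈(15K/(p·t))·log((eK+1)/ε)⌉₊` for the Boolean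
witness star with a uniform entry list and `4t ≤ (1−t)w_0`. [ours] -/
theorem boolWitness_slowSwap_mixingTime_two_sided (hK : 1 ≤ K) (hm : 1 ≤ m) (ht0 : 0 < t) (ht1 : t < 1) (hw0 : ∀ k, 0 ≤ w k)
    (hw00 : 0 < w 0) (hw1 : ∑ k, w k = 1) (hp0 : 0 < p) (hp1 : p ≤ 1) (hθ0 : 0 < θ) (hθ1 : θ < 1)
    {c : ℕ} (hc1 : 1 ≤ c) (hunif : ∀ i : Fin K, (univ.filter fun r : Fin m => κ r = i).card = c)
    (hslow : 4 * t ≤ (1 - t) * w 0) {ε : ℝ} (hε0 : 0 < ε) (hε : ε + K * θ < 1) :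
    K / (t * p) * Real.log (((K : ℝ) + 1) * (1 - ε - K * θ))
      ≤ (mixingTime (fun a b : Fin (K + 1) → Bool =>
              t * ptGraphSwap (fun (k : Fin (K + 1)) (b : Bool) =>
                    if k = 0 then (if b then p * θ else 1 - p * θ) else (if b then θ else 1 - θ))
                  (fun r : Fin m => (((0 : Fin (K + 1)), (κ r).succ) : Fin (K + 1) × Fin (K + 1)))
                  (fun _ : Fin m => Equiv.refl Bool) a b
                + (1 - t) * prodKernel w (fun (k : Fin (K + 1)) (u v : Bool) =>
                    if k = 0 then (if v then p * θ else 1 - p * θ) else (if u = v then (1 : ℝ) else 0)) a b)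
            (tensorFun (fun (k : Fin (K + 1)) (b : Bool) =>
              if k = 0 then (if b then p * θ else 1 - p * θ) else (if b then θ else 1 - θ))) ε : ℝ)
    ∧ mixingTime (fun a b : Fin (K + 1) → Bool =>
              t * ptGraphSwap (fun (k : Fin (K + 1)) (b : Bool) =>
                    if k = 0 then (if b then p * θ else 1 - p * θ) else (if b then θ else 1 - θ))
                  (fun r : Fin m => (((0 : Fin (K + 1)), (κ r).succ) : Fin (K + 1) × Fin (K + 1)))
                  (fun _ : Fin m => Equiv.refl Bool) a b
                + (1 - t) * prodKernel w (fun (k : Fin (K + 1)) (u v : Bool) =>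
                    if k = 0 then (if v then p * θ else 1 - p * θ) else (if u = v then (1 : ℝ) else 0)) a b)
            (tensorFun (fun (k : Fin (K + 1)) (b : Bool) =>
              if k = 0 then (if b then p * θ else 1 - p * θ) else (if b then θ else 1 - θ))) ε
      ≤ ⌈15 * K / (p * t) * Real.log ((Real.exp 1 * K + 1) / ε)⌉₊ := by
  have hmK : (m : ℝ) = c * K := uniformList_card κ hunif
  have hcpos : (0 : ℝ) < c := Nat.cast_pos.mpr (by omega)
  refine ⟨?_, ?_⟩
  · -- the floor of chapter O, with `m = cK`, `c_max = c`
    have h := boolWitness_mixingTime_ge_klogk κ hK hm ht0 ht1 hw0 hw00 hw1 hp0 hp1 hθ0 hθ1 hc1 (fun i => (hunif i).ge) (cmax := c)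
      (fun i => (hunif i).le) (fun _ => true) (fun _ => rfl) hε0 hε
    have e : (m : ℝ) / (t * c * p) = K / (t * p) := by rw [hmK]; field_simp
    rw [e] at h
    exact h
  · -- the ceiling of chapter U on the witness: `p·μ_1 ≤ μ_0`, `W(⊤) = 1/p = W_lo`
    have hpθ1 : p * θ < 1 := by nlinarith
    have h10 : (1 : Fin (K + 1)) ≠ 0 := by
      rw [Ne, Fin.one_eq_zero_iff]; omega
    have hμ : ∀ (k : Fin (K + 1)) (x : Bool), 0 < (fun (k : Fin (K + 1)) (b : Bool) =>
        if k = 0 then (if b then p * θ else 1 - p * θ) else (if b then θ else 1 - θ)) k x := by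
      intro k x
      by_cases hk : k = 0
      · simp only [hk, if_true]; split_ifs; exacts [mul_pos hp0 hθ0, by linarith]
      · simp only [hk, if_false]; split_ifs; exacts [hθ0, by linarith]
    have hμ1 : ∀ k : Fin (K + 1), ∑ u, (fun (k : Fin (K + 1)) (b : Bool) =>
        if k = 0 then (if b then p * θ else 1 - p * θ) else (if b then θ else 1 - θ)) k u = 1 := by
      intro k
      by_cases hk : k = 0
      · simp only [hk, if_true]; exact sum_bool_law _
      · simp only [hk, if_false]; exact sum_bool_law _
    have hM0 : ∀ u v : Bool, (fun (k : Fin (K + 1)) (u v : Bool) =>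
        if k = 0 then (if v then p * θ else 1 - p * θ) else (if u = v then (1 : ℝ) else 0)) 0 u v
        = (fun (k : Fin (K + 1)) (b : Bool) => if k = 0 then (if b then p * θ else 1 - p * θ) else (if b then θ else 1 - θ)) 0 v := by
      intro u v; simp only [if_true]
    have hidle : ∀ (i : Fin K) (u v : Bool), (fun (k : Fin (K + 1)) (u v : Bool) =>
        if k = 0 then (if v then p * θ else 1 - p * θ) else (if u = v then (1 : ℝ) else 0)) i.succ u v = if v = u then 1 else 0 := by
      intro i u v
      show (if i.succ = (0 : Fin (K + 1)) then (if v then p * θ else 1 - p * θ) else (if u = v then (1 : ℝ) else 0)) = if v = u then 1 else 0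
      rw [if_neg (Fin.succ_ne_zero i)]
      by_cases h : u = v
      · subst h; rfl
      · rw [if_neg h, if_neg (Ne.symm h)]
    have hhom : ∀ i : Fin K, (fun (k : Fin (K + 1)) (b : Bool) => if k = 0 then (if b then p * θ else 1 - p * θ) else (if b then θ else 1 - θ)) i.succ
        = (fun (k : Fin (K + 1)) (b : Bool) => if k = 0 then (if b then p * θ else 1 - p * θ) else (if b then θ else 1 - θ)) 1 := by
      intro i; funext b
      show (if i.succ = (0 : Fin (K + 1)) then (if b then p * θ else 1 - p * θ) else (if b then θ else 1 - θ))
        = if (1 : Fin (K + 1)) = 0 then (if b then p * θ else 1 - p * θ) else (if b then θ else 1 - θ)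
      rw [if_neg (Fin.succ_ne_zero i), if_neg h10]
    have hdom : ∀ u : Bool, p * (fun (k : Fin (K + 1)) (b : Bool) => if k = 0 then (if b then p * θ else 1 - p * θ) else (if b then θ else 1 - θ)) 1 u
        ≤ (fun (k : Fin (K + 1)) (b : Bool) => if k = 0 then (if b then p * θ else 1 - p * θ) else (if b then θ else 1 - θ)) 0 u := by
      intro u
      show p * (if (1 : Fin (K + 1)) = 0 then (if u then p * θ else 1 - p * θ) else (if u then θ else 1 - θ))
        ≤ if (0 : Fin (K + 1)) = 0 then (if u then p * θ else 1 - p * θ) else (if u then θ else 1 - θ)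
      rw [if_neg h10, if_pos rfl]
      cases u
      · simp only [Bool.false_eq_true, if_false]; nlinarith
      · simp only [if_true]; exact le_rfl
    have hWlo : ∀ u v : Bool, u ≠ v → 1 / p ≤ max
        ((fun (k : Fin (K + 1)) (b : Bool) => if k = 0 then (if b then p * θ else 1 - p * θ) else (if b then θ else 1 - θ)) 1 u
          / (fun (k : Fin (K + 1)) (b : Bool) => if k = 0 then (if b then p * θ else 1 - p * θ) else (if b then θ else 1 - θ)) 0 u)
        ((fun (k : Fin (K + 1)) (b : Bool) => if k = 0 then (if b then p * θ else 1 - p * θ) else (if b then θ else 1 - θ)) 1 v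
          / (fun (k : Fin (K + 1)) (b : Bool) => if k = 0 then (if b then p * θ else 1 - p * θ) else (if b then θ else 1 - θ)) 0 v) := by
      have htop : (fun (k : Fin (K + 1)) (b : Bool) => if k = 0 then (if b then p * θ else 1 - p * θ) else (if b then θ else 1 - θ)) 1 true
          / (fun (k : Fin (K + 1)) (b : Bool) => if k = 0 then (if b then p * θ else 1 - p * θ) else (if b then θ else 1 - θ)) 0 true = 1 / p := by
        show (if (1 : Fin (K + 1)) = 0 then (if true then p * θ else 1 - p * θ) else (if true then θ else 1 - θ))
          / (if (0 : Fin (K + 1)) = 0 then (if true then p * θ else 1 - p * θ) else (if true then θ else 1 - θ)) = 1 / p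
        rw [if_neg h10, if_pos rfl, if_pos rfl, if_pos rfl]
        field_simp
      intro u v huv
      cases u
      · cases v
        · exact absurd rfl huv
        · rw [htop]; exact le_max_right _ _
      · rw [htop]; exact le_max_left _ _
    have h := homStar_mixingTime_le_slowSwap'' κ
      (μ := fun (k : Fin (K + 1)) (b : Bool) => if k = 0 then (if b then p * θ else 1 - p * θ) else (if b then θ else 1 - θ))
      (M := fun (k : Fin (K + 1)) (u v : Bool) => if k = 0 then (if v then p * θ else 1 - p * θ) else (if u = v then (1 : ℝ) else 0))
      hm ht0 ht1 hw0 hw00 hw1 hμ hμ1 hM0 hidle hhom hunif hp0 hdom (Wlo := 1 / p) (by positivity) hWlo hslow hε0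
    have e : Real.exp 1 * K / (p * (1 / p)) + 1 = Real.exp 1 * K + 1 := by field_simp
    rw [e] at h
    exact h

end Witness

end Summit.Ventures.LatticeQCDFlow.Scaling

end
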